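import Summits.SmoothPoincare4.SmoothPoincare4.Theses.CongruenceShadows
import Summits.SmoothPoincare4.SmoothPoincare4.Theorems.ShadowsStandard.Negative.ShadowLevels
import HarnessLib
import HarnessLib.Audit

/-!
# Line `prym-layer-stable-rank` for crux `CongruenceShadows.ShadowsStandard` (stmt-SmoothPoincare4-14593)

Skeleton (crux-plan, round 1, idea `prym-layer-stable-rank`, triage r1-1/r1-2/r1-3: pass, merge with
`prym-layers-clifford-witt` adopted): **Hensel down the characteristic tower.** The crux says: for
every `(3+3m; m+1)` group trisection `K` of the trivial group and every characteristic finite-index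
`M ≤ S = S_{3+3m}` the level-`M` shadow `(Kᵢ·M)ᵢ` is the image of the standard shadow `(Nᵢ·M)ᵢ`
under ONE automorphism of `S` (`ShadowStandardAt m K M`, read back from
`Theorems/ShadowsStandard/Negative/ShadowLevels.lean`). We PROVE here (sorry-free) the exact
CHIEF-LAYER REDUCTION of the card (`ChiefLayerReduction`, which triage r1-3 asked to be demoted from a
crux-sized item to bookkeeping — it is now a theorem of this file, `descent`): standardness descends
from `M = ⊤` (trivial) along an `Aut S`-chief series of every characteristic finite quotient, one
LAYER `L ⊋ M` at a time (`L` a minimal characteristic overgroup of `M`: exists by finiteness of the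
interval `[M, ⊤]`; then `L/M` is characteristically simple, i.e. `T^n`), after transporting `K` so
that it is standard ON THE NOSE at the upper level `L` (`standardAt_of_relative`, using the
`Aut S`-invariance of the group-trisection axioms, `isGroupTrisection_map`). What is NOT proved is
exactly the content of the idea, cut into FOUR registered stubs by LAYER TYPE — the four regimes have
four different engines:

* Stub 1 `stub_tameAbelianLayer` — ABELIAN chief layer `M/M' ≅ 𝔽_pⁿ` (`⁅M,M⁆ ≤ M'`) with
  `p ∤ [S:M]` (TAME Prym layer: `M/M'` is an `Aut S`-irreducible quotient of the Prym module
  `H₁(Σ̃_M; 𝔽_p)` of the `Q = S/M`-cover; Maschke/Clifford sorting + `H¹ = 0` + big monodromy of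
  Prym representations — the `prym-layers-clifford-witt` rung, merged here as the triagers proposed);
* Stub 2 `stub_wildAbelianLayer` — ABELIAN chief layer with `p ∣ [S:M]` (WILD Prym layer: Fox
  calculus over the finite ring `𝔽_p[Q]`, Bass stable rank one, lifted-twist transvections, Johnson-type
  extension data; contains every `p`-group level, i.e. the finite truncations of the nilpotent crux 14594);
* Stub 3 `stub_semisimpleTop` — `M` MAXIMAL characteristic with `S/M` non-abelian, i.e.
  `S/M ≅ T^O` for a non-abelian finite simple `T` and ONE `Out S`-orbit `O ⊆ Epi(S,T)/Aut T`
  (Hall): the semisimple stratum, engine = Dunfield–Thurston mixing / the Venn argument of card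
  `semisimple-venn-monodromy`, per orbit (triage r1-3 sharpening);
* Stub 4 `stub_nonabelianDeep` — a NON-ABELIAN chief layer `L/M ≅ T^n` strictly below the top
  (`L ≠ S`), relative to a standard level `L`: the wreath-product regime
  (`Hom(L,T) = Hom_Q(S, T ≀ Q)`), acting group = the level-`L` triple stabiliser only; no engine —
  the honest hard residual (card, barrier note B-DT). HARDEST.

Chain (all arrows not marked "stub" are proved in this file):

  `ShadowStandardAt m K ⊤` (proved, `standardAt_top`)
  —[strong induction on `[S:M]`: minimal characteristic `L ⊋ M` (`exists_minimal_char_gt`),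
    `[S:L] < [S:M]` gives `ShadowStandardAt m K L`; transport `K ↦ ψ_L⁻¹ K`
    (`standardAt_of_relative`); dichotomy `⁅L,L⁆ ≤ M` (abelian chief layer: Stub 1 if
    `gcd([S:L],[L:M]) = 1`, i.e. `p ∤ [S:L]`, else Stub 2) / `L = ⊤` (Stub 3) / else Stub 4]→
  `ShadowStandardAt m K M` for every characteristic finite-index `M` (`descent`)
  —[read-back `shadowsStandard_iff`]→ `ShadowsStandard` (`ShadowsStandard_of`, BY NAME).

`ShadowsStandard_of : …CongruenceShadows.ShadowsStandard` is the unique theorem of this file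
concluding the crux by name; `standardAt_of_parts` is the same composition with the four statements
as explicit hypotheses (pure logic, kernel-checked, concluding `ShadowStandardAt`).

Disproof.lean (cdisprove cycle 1, NO KILL) / landed `Negative/ShadowLevels.lean` (p75004) honoured —
and SHARPENED to the stub that needs each hypothesis (certificates §6, sorry-free):
`shadowsStandard_false_without_trisection` ⟹ `tame_false_without_trisection`: Stub 1 with
`IsGroupTrisection` dropped is FALSE already at its first instance `(M, M') = (⊤, M_{ℤ/2})`, `m = 0`
(witness `K = ⊥`); `shadowsStandard_false_without_characteristic` ⟹
`tame_false_without_characteristic`: Stub 1 with `M'.Characteristic` dropped is FALSE at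
`(⊤, ker χ_{b₂})` for the relabelled standard triple; so any proof of Stub 1 uses the trisection
axioms (in the line: admissibility of the layer configuration = unimodularity of the Fox blocks /
Clifford sorting needs `P̄₀P̄₁P̄₂ = Q`) and characteristic-ness of BOTH ends of the layer (the layer
must be an `Aut S`-module). `withoutFiniteIndex_iff_unstable` / `uniform_iff_unstable`: respected —
`ψ` is rebuilt layer by layer, never uniform in `M`, and every level is finite (Artinian coefficient
rings). Finding 5 (level gate false at `[S,S]S²` without side conditions): no stub asserts a bare
Dedekind/gate identity; every stub quantifies over ACTUAL group trisections of `{1}` standard at the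
upper level. §3 `card_homShadow_eq`: the kill format of Stubs 3/4 (per-orbit Hall counts).
`stubs_of_shadowsStandard`: each stub is implied by the crux (none is a strengthening that could be
false while the crux holds). `ledger negatives --problem SmoothPoincare4` = 0 (2026-08-16).
-/

noncomputable section

set_option linter.dupNamespace false

open Literature.Topology.FourManifolds
open Summit.SmoothPoincare4.SmoothPoincare4.Theses.CongruenceShadows
open Summit.SmoothPoincare4.SmoothPoincare4.Theorems.ShadowsStandard.Negative
  (N ShadowStandardAt stabilizeIter_isGroupTrisection levelSubgroup levelSubgroup_le_ker
    levelSubgroup_characteristic levelSubgroup_finiteIndex levelSubgroup_zmod2_ne_top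
    iSup_s4Kernels_eq_top genChar of_not_mem_ker_genChar rotatedKernels
    rotatedKernels_isGroupTrisection s4Kernels_zero_le_ker s4Kernels_one_sup_ker_eq_top)

namespace Summit.SmoothPoincare4.SmoothPoincare4.Cruxes.ShadowsStandard.PrymLayerStableRank

/-! ## 0. Notation, read-back, sorry-free transport lemmas -/

/-- `S_g` at the crux's genus `g = 3 + 3m`. -/
abbrev S (m : ℕ) : Type := SurfaceGroup (3 + 3 * m)

/-- READ-BACK: the crux is literally "standard shadow at every characteristic finite-index level"
(`ShadowStandardAt m K M := ∃ ψ : S ≃* S, ∀ i, (N m i ⊔ M).map ψ = K i ⊔ M`,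
`N m = s4Kernels.stabilizeIter m`, both from `Negative/ShadowLevels.lean`). -/
theorem shadowsStandard_iff :
    ShadowsStandard ↔ ∀ (m : ℕ) (K : TrisectionKernels (3 + 3 * m)),
      IsGroupTrisection (3 + 3 * m) (m + 1) (PUnit : Type) K →
      ∀ M : Subgroup (S m), M.Characteristic → M.FiniteIndex → ShadowStandardAt m K M :=
  Iff.rfl

/-- NORMALISED AT LEVEL `L`: the level-`L` shadow of `K` is the standard one ON THE NOSE. -/
def NormalisedAt (m : ℕ) (K : TrisectionKernels (3 + 3 * m)) (L : Subgroup (S m)) : Prop :=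
  ∀ i : Fin 3, K i ⊔ L = N m i ⊔ L

section transport

variable {G : Type*} [Group G]

/-- `H ↦ H.map` along a composite of automorphisms. -/
theorem map_trans (e₁ e₂ : G ≃* G) (H : Subgroup G) :
    H.map (e₁.trans e₂).toMonoidHom = (H.map e₁.toMonoidHom).map e₂.toMonoidHom := by
  rw [Subgroup.map_map]
  rfl

/-- `e⁻¹` undoes `e` on subgroups. -/
theorem map_map_symm (e : G ≃* G) (H : Subgroup G) :
    (H.map e.toMonoidHom).map e.symm.toMonoidHom = H := by
  ext x
  simp

/-- `e` undoes `e⁻¹` on subgroups. -/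
theorem map_symm_map (e : G ≃* G) (H : Subgroup G) :
    (H.map e.symm.toMonoidHom).map e.toMonoidHom = H := by
  ext x
  simp

/-- Characteristic subgroups are `Aut`-invariant (the form used throughout). -/
theorem map_char (ψ : G ≃* G) {M : Subgroup G} (hM : M.Characteristic) :
    M.map ψ.toMonoidHom = M :=
  (Subgroup.characteristic_iff_map_eq.mp hM) ψ

end transport

variable {g : ℕ}

/-- **`Aut S_g`-invariance of the group-trisection property** (Abrams–Gay–Kirby: isomorphic kernel
triples have isomorphic cubes of quotients): each of the seven quotients of `α • K` is isomorphic
to the corresponding quotient of `K` via `QuotientGroup.congr`. -/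
theorem isGroupTrisection_map {k : ℕ} {G : Type*} [Group G] {K : TrisectionKernels g}
    (hK : IsGroupTrisection g k G K) (α : SurfaceGroup g ≃* SurfaceGroup g) :
    IsGroupTrisection g k G (fun i => (K i).map α.toMonoidHom) := by
  have hsurj : Function.Surjective (α : SurfaceGroup g →* SurfaceGroup g) := α.surjective
  have himg : ∀ i, ((K i).map α.toMonoidHom : Set (SurfaceGroup g)) = α '' (K i) := fun i =>
    Subgroup.coe_map _ _
  have hnc : ∀ s : Set (SurfaceGroup g),
      (Subgroup.normalClosure s).map (α : SurfaceGroup g →* SurfaceGroup g) =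
        Subgroup.normalClosure (α '' s) := fun s =>
    Subgroup.map_normalClosure s _ hsurj
  refine ⟨fun i => (hK.normal i).map α.toMonoidHom α.surjective, fun i => ?_, fun i j hij => ?_, ?_⟩
  · refine (hK.free_quotient i).of_mulEquiv (QuotientGroup.congr _ _ α ?_)
    simp only [hnc, himg]
  · refine (hK.free_pairQuotient i j hij).of_mulEquiv (QuotientGroup.congr _ _ α ?_)
    simp only [hnc, himg, Set.image_union]
  · obtain ⟨e⟩ := hK.triple
    refine ⟨(QuotientGroup.congr _ _ α ?_).symm.trans e⟩
    simp only [hnc, himg, Set.image_iUnion]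

variable {m : ℕ}

/-- BASE of the descent: at the level `M = ⊤` every shadow is standard (`ψ = 1`). -/
theorem standardAt_top (K : TrisectionKernels (3 + 3 * m)) : ShadowStandardAt m K ⊤ :=
  ⟨MulEquiv.refl _, fun i => by simp⟩

/-- **Normalise at the upper level, solve relatively, compose.** If `K` is standard at a
characteristic level `L` (via `φ`), and the RELATIVE problem "every group trisection `K'` of `{1}`
that is standard ON THE NOSE at level `L` is standard at level `M`" is solved, then `K` is standard
at `M`: apply the relative statement to `K' = φ⁻¹ • K` (a group trisection by `isGroupTrisection_map`,
normalised at `L` because `φ(L) = L`) and compose the answer with `φ` (`φ(M) = M`). -/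
theorem standardAt_of_relative {K : TrisectionKernels (3 + 3 * m)}
    (hK : IsGroupTrisection (3 + 3 * m) (m + 1) (PUnit : Type) K) {L M : Subgroup (S m)}
    (hL : L.Characteristic) (hM : M.Characteristic) (hKL : ShadowStandardAt m K L)
    (hrel : ∀ K' : TrisectionKernels (3 + 3 * m),
      IsGroupTrisection (3 + 3 * m) (m + 1) (PUnit : Type) K' → NormalisedAt m K' L →
      ∃ ψ : S m ≃* S m, ∀ i : Fin 3, (N m i ⊔ M).map ψ.toMonoidHom = K' i ⊔ M) :
    ShadowStandardAt m K M := by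
  obtain ⟨φ, hφ⟩ := hKL
  have hK' : IsGroupTrisection (3 + 3 * m) (m + 1) (PUnit : Type)
      (fun i => (K i).map φ.symm.toMonoidHom) := isGroupTrisection_map hK φ.symm
  have hlev : NormalisedAt m (fun i => (K i).map φ.symm.toMonoidHom) L := by
    intro i
    show (K i).map φ.symm.toMonoidHom ⊔ L = N m i ⊔ L
    have e := congrArg (Subgroup.map φ.symm.toMonoidHom) (hφ i)
    rw [map_map_symm, Subgroup.map_sup, map_char φ.symm hL] at e
    exact e.symm
  obtain ⟨ψ, hψ⟩ := hrel _ hK' hlev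
  have hψ' : ∀ i : Fin 3, (N m i ⊔ M).map ψ.toMonoidHom = (K i).map φ.symm.toMonoidHom ⊔ M := hψ
  refine ⟨ψ.trans φ, fun i => ?_⟩
  rw [map_trans, hψ' i, Subgroup.map_sup, map_symm_map, map_char φ hM]

/-! ## 1. TAME ABELIAN (Prym) LAYERS

Stub 1 · `stub_tameAbelianLayer` · for every `(3+3m; m+1)` group trisection `K` of `{1}`, every
pair of characteristic finite-index levels `M' < M` of `S = S_{3+3m}` such that `M/M'` is an
ABELIAN (`⁅M,M⁆ ≤ M'`) `Aut S`-CHIEF layer (no characteristic subgroup strictly between) of order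
prime to `[S:M]`, if `K` is standard on the nose at level `M` (`Kᵢ·M = Nᵢ·M`) then its level-`M'`
shadow is standard: `∃ ψ ∈ Aut S, ψ(Nᵢ·M') = Kᵢ·M'`. (A finite abelian characteristically simple
group is elementary abelian, so `M/M' ≅ 𝔽_pⁿ` with `p ∤ |Q|`, `Q := S/M`; by `ShadowStandardAt.mono`
and the induction of §5 run inside the interval `[M^p[M,M], M]`, the registered chief form is
EQUIVALENT to the full-layer form "standard at `M` ⟹ standard at the Prym level `M^p[M,M]`" of the
card (`PrymStep`) for tame `p` — the lead may prove the full-layer form as a `--supports` helper and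
read off every chief instance.)

OBJECT. `V := M/M'` is a finite `𝔽_p[Q]`-module, an `Aut S`-irreducible quotient of the PRYM MODULE
`H₁(Σ̃_M; 𝔽_p) = M/M^p[M,M]` of the `Q`-cover `Σ̃_M → Σ` (Chevalley–Weil: `H₁(Σ̃_M;𝔽_p) ≅
𝔽_p² ⊕ 𝔽_p[Q]^{2g-2}` for `p ∤ |Q|`; computable by Fox calculus from `∂₂ = Fox(∏[aᵢ,bᵢ])`, Lyndon). The level-`M'` shadow of the handlebody kernel `Kᵢ` is
the normal subgroup `Pᵢ := Kᵢ·M'/M' ⊴ S/M'`; it lies over `P̄ᵢ := Kᵢ·M/M = Nᵢ·M/M` (standard, by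
hypothesis) with `Pᵢ ∩ V = Wᵢ := (Kᵢ ∩ M)·M'/M' = ker(V → H₁ of the induced cover of Hᵢ)`.
MECHANISM (card + clifford-witt, verified by all three triagers): (i) COPRIME ⟹ `V` semisimple
(Maschke) and `H¹(P̄ᵢ; V/Wᵢ) = H²(…) = 0`, so `Pᵢ` is DETERMINED by `(P̄ᵢ, Wᵢ)` — the tame step is a
statement about the submodule triple `(W₀,W₁,W₂)` only; (ii) CLIFFORD SORTING: `P̄₀P̄₁P̄₂ = Q`
(`N₀N₁N₂ = S`) ⟹ on each `Q`-isotypic component on which `P̄ᵢ` acts non-trivially `Wᵢ` is the whole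
component (`Wᵢ ⊇ I_{P̄ᵢ}·V`: `H₁(Σ̃) → H₁(∂Ĥᵢ)` factors through `P̄ᵢ`-coinvariants), so every
component carries single-handlebody, Heegaard-pair or Lagrangian data, never "triple" data —
numerics (dimensions/Witt types) are those of covers of `Hᵢ ≃ ♮ᵍ S¹×D²`, `Hᵢ ∪ Hⱼ ≅ #ᵏ S¹×S²`
(`free_quotient`, `free_pairQuotient` — this is where `IsGroupTrisection` is consumed; certificate
`tame_false_without_trisection`) hence K-FREE; Witt's theorem over the finite semisimple ring makes
`(W₀,W₁,W₂)(K)` and `(W₀,W₁,W₂)(N)` abstractly isometric component by component; (iii) PATCH = the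
only deep and the only K-free-but-unproved input: the image of the level-`M` triple stabiliser
`Γ(M) := Stab_{Aut S}(N₀M, N₁M, N₂M)` (it contains the level-`M` congruence subgroup `Aut S[M]`,
the trisection group `A∩B∩C`, lifted multitwists) in `Aut_{𝔽_p[Q]}(V)` is TRANSITIVE on
admissible triples — by Bass (`sr 𝔽_p[Q] = 1`: `E_n` acts transitively on unimodular frames,
`n ≥ 2`) it suffices that it contains the elementary transvections of the standard flag, i.e. BIG
MONODROMY of the Prym representation restricted to `Γ(M)`: Looijenga 1997 (abelian `Q`, up to finite
index), Grunewald–Larsen–Lubotzky–Malestein arXiv:1307.2593 (redundant covers), Bader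
arXiv:2308.14095 Thm 2.1/2.2 (READ by triage: handlebody group ↦ full parabolic, twist group ↦ all
self-adjoint `B` for cyclic covers), + strong approximation (Nori–Weisfeiler) for `p ≥ p₀`.
K-FREE FORM (the card's Transfer LT(M,M'), decidable per instance, NOT typed as a stub because its
admissibility side conditions must carry the homology-sphere data into the layer — Disproof finding 5
kills the bare identity): `Γ(M)` is transitive on `{(X₀,X₁,X₂) : M' ≤ Xᵢ ⊴ S, Xᵢ·M = Nᵢ·M,
(Q; X̄ᵢ) and (Q; X̄ᵢ, X̄ⱼ) of the standard single/pair types, X₀X₁X₂ = S}`.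
FIRST INSTANCES: `M = ⊤` (then `M' = [S,S]S^p`, `Sp_{2g}(𝔽_p)` being irreducible on `𝔽_p^{2g}`):
the Lagrangian triple over `𝔽_p` = item 14599 `AbelianShadowStandard` mod `p`, hand-proved by the
refuter (`q³(q+1)` admissible Lagrangians, ONE `Stab(L₀)∩Stab(L₁)`-orbit, triage r1-1; 24 = one orbit
of the 192-element Goeritz image at `q = 2`, triage r1-2); `(m, M) = (0, [S,S]S²)`, `p = 3`: the
`Aut S`-chief pieces of `H₁(Σ̃_M;𝔽₃)` (`dim 258 = 6 + 63·4`: the old part `𝔽₃⁶` and the new part,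
63 blocks `Sp₄(𝔽₃)` permuted transitively by `Sp₆(𝔽₂)`) = the `(g,d,p) = (3,2,3)` Prym rung of
clifford-witt — the line's CHEAPEST FALSIFIER (is the image of `Mod₃[2]` in the new part the full
subdirect product on the 63 blocks?).
WHY IT MIGHT FAIL: thin Prym image at FIXED genus (Putman–Wieland regime; Landesman–Litt
arXiv:2205.15352 need `g` large against the rank) — some admissible configuration needs an elementary
move not realised by `Γ(M)`; then the step stalls exactly there and the configuration is a candidate
finite-group certificate of non-standardness (Disproof §3). Implied by the crux
(`stubs_of_shadowsStandard`). Size L (XL with vendoring: Chevalley–Weil, Witt over finite rings,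
Looijenga/Bader images, strong approximation). -/
def TameAbelianLayerStep : Prop :=
  ∀ (m : ℕ) (K : TrisectionKernels (3 + 3 * m)),
    IsGroupTrisection (3 + 3 * m) (m + 1) (PUnit : Type) K →
    ∀ M M' : Subgroup (S m), M.Characteristic → M.FiniteIndex → M'.Characteristic → M'.FiniteIndex →
    M' < M → (∀ X : Subgroup (S m), X.Characteristic → M' < X → X ≤ M → X = M) →
    ⁅M, M⁆ ≤ M' → Nat.Coprime M.index (M'.relIndex M) →
    NormalisedAt m K M →
    ∃ ψ : S m ≃* S m, ∀ i : Fin 3, (N m i ⊔ M').map ψ.toMonoidHom = K i ⊔ M'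

/-! ## 2. WILD ABELIAN (Prym) LAYERS

Stub 2 · `stub_wildAbelianLayer` · the same statement for abelian `Aut S`-chief layers
`M/M' ≅ 𝔽_pⁿ` whose prime DIVIDES `[S:M]` (`p ∣ |Q|`, `Q = S/M`); again equivalent to the
full-layer form `M ⟹ M^p[M,M]` for wild `p`.

OBJECT: as in Stub 1, but the Prym module `H₁(Σ̃_M;𝔽_p)` is a NON-semisimple `𝔽_p[Q]`-module (its
`Aut S`-chief pieces `V` are the layers of a radical-type filtration) and `H¹(P̄ᵢ; ·) ≠ 0` in
general: the shadow `Pᵢ = KᵢM'/M'` is an EXTENSION CLASS over `(P̄ᵢ, Wᵢ)`, not determined by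
`Wᵢ`. Two sub-mechanisms (the foreseen layer-2 split of this stub, `lin`/`ext`): (lin) the
submodule triple `(W₀,W₁,W₂)` is standardised by `Γ(M)` — the card's lever proper: EVERYTHING about
the standard triple is uniformly computable by FOX CALCULUS over the finite (Artinian) ring
`R = 𝔽_p[Q]` (or `(ℤ/p^k)[Q]` for several layers at once; `V = H₁` of `R →∂₂ R^{2g} →∂₁ R`,
`Wᵢ(N)` = row space of the Fox images of the
meridians of `Hᵢ`, `K` enters only through the reduction of the integral Fox Jacobian
`J(ρ) ∈ GL_{2g}(ℤ[S])` of the gluing automorphism, Birman Ch. 3), the trisection axioms become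
UNIMODULARITY of Fox blocks (`π₁X = 1`), and `sr R = 1` (Bass: semilocal rings) gives
`GL_n(R) = E_n(R)·GL_1(R)` and `E_n`-transitivity on unimodular rows — the algebraic room that
`ℤ[F_k]` (home of the Andrews–Curtis / relation-gap obstructions, StrictPropertyTwoRBarrier) lacks;
the abelian-level hand proof (unipotent shears kill the three quadratic forms independently) is the
case `Q = 1`; (ext) the extension classes are moved by the unipotent part of `Γ(M)` acting through a
JOHNSON-TYPE homomorphism `Aut S[M] → Hom_Q(…, V)`; at CENTRAL layers (`S` acting trivially on
`M/M'`: the `p`-group levels) the `lin` data are determined by the level above (`Nᵢ ∩ [S,S] =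
[Nᵢ,S]`, 5-term sequence) and ALL content is `ext` = the finite truncations of the nilpotent crux
`NilpotentShadowsStandard` (item 14594; its why-it-might-fail — Johnson-image / Morita-trace
obstructions — is inherited here verbatim). FIRST INSTANCE: `(m, M) = (0, [S,S]S²)`, `p = 2`,
`Q = (ℤ/2)⁶`, `Σ̃` of genus 129, `dim_{𝔽₂} H₁(Σ̃;𝔽₂) = 258`: the card's LT(M₂,2) — build the module
by Fox calculus, the three `Wᵢ(N)`, the group generated by the reductions of Humphries-generator Fox
Jacobians inside the level stabiliser, count orbits on admissible `W` (kit-hours; one orbit ⟹ the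
`lin` half of this instance for all `K`), then read off the chief pieces.
WHY IT MIGHT FAIL: (lin) an admissible non-realised elementary move (thin image, as in Stub 1 but
without semisimplicity to localise it); (ext) an arithmetic/Johnson obstruction separating extension
classes that the graded gate identity (card artin-approximation K1, defect 0 in ten computed cases)
cannot see. Implied by the crux. Size XL. Sources: Fox 1953, Lyndon 1950, Gaschütz 1954, Bass 1964
doi:10.1007/bf02684689, Vaserstein 1971, Birman 1974 Ch. 3, Looijenga 1997
doi:10.1023/a:1004909416648, PutmanWieland2013 arXiv:1106.2747, Hain2008 arXiv:0802.0814,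
Lambertcole2019 arXiv:1901.10834, Morita 1993. -/
def WildAbelianLayerStep : Prop :=
  ∀ (m : ℕ) (K : TrisectionKernels (3 + 3 * m)),
    IsGroupTrisection (3 + 3 * m) (m + 1) (PUnit : Type) K →
    ∀ M M' : Subgroup (S m), M.Characteristic → M.FiniteIndex → M'.Characteristic → M'.FiniteIndex →
    M' < M → (∀ X : Subgroup (S m), X.Characteristic → M' < X → X ≤ M → X = M) →
    ⁅M, M⁆ ≤ M' → ¬ Nat.Coprime M.index (M'.relIndex M) →
    NormalisedAt m K M →
    ∃ ψ : S m ≃* S m, ∀ i : Fin 3, (N m i ⊔ M').map ψ.toMonoidHom = K i ⊔ M'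

/-! ## 3. THE SEMISIMPLE TOP STRATUM

Stub 3 · `stub_semisimpleTop` · for every `(3+3m; m+1)` group trisection `K` of `{1}` and every
MAXIMAL characteristic finite-index `M < S` with `S/M` NON-ABELIAN, the level-`M` shadow of `K` is
standard.

OBJECT. `S/M` is characteristically simple and non-abelian, hence `≅ T^O` with `T` a non-abelian
finite simple group and — because a second `Aut S`-orbit of factors would give a characteristic
subgroup strictly between `M` and `S` — `O` ONE `Out(S) = Mod^±(Σ)`-orbit of `Epi(S,T)/Aut T`
(P. Hall), `M = M_O := ⋂_{φ ∈ O} ker φ`. Normal subgroups of `T^O` are sub-products, so the shadow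
IS the subset triple `Eᵢ(K) ∩ O`, `Eᵢ(K) := {φ̄ : φ(Kᵢ) = 1}` (card `semisimple-venn-monodromy`,
verified line by line by all three triagers), and `Aut S` acts on `O` through the permutation group
`G_O := im(Mod^± → Sym O)`. MECHANISM: (i) the seven Venn cells of `(E₀,E₁,E₂)` have sizes forced
by the axioms IN TOTAL over all orbits (`|Eᵢ| = |Epi(F_g,T)/Aut T|`, `|Eᵢ ∩ Eⱼ| = |Epi(F_k,T)/Aut T|`,
`E₀∩E₁∩E₂ = ∅`, all in the class-`0` part `𝓐⁰`); PER ORBIT they are the Hall counts of Disproof §3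
(`card_homShadow_eq`) — equal for `K` and `N` or the crux is refuted by a finite certificate;
(ii) MonodromyAlt(g,T,O): `G_O ⊇ Alt(O)` — Dunfield–Thurston Thm 7.4 gives it for `g ≥ g₀(T)`
(read verbatim by grounder g24-29), open at fixed genus ("we suspect `g ≥ 3`"); (i)+(ii) + room for a
parity-fixing transposition (`|O| ≫ 4|E|`, e.g. `|𝓐₃⁰(A₅)| ≈ 3.3·10⁶` vs `|Eᵢ| ≈ 1.7·10³`) give a
`ψ ∈ Aut S` carrying the three subsets simultaneously. FIRST INSTANCE: `(m, T) = (0, A₅)`: orbit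
decomposition of `Mod₃` on `Epi(S₃,A₅)/Aut A₅` (≈ 6.7·10⁶ points, Humphries generators as
permutations — kit-scale), then per-orbit cell counts for the 28 Aranda–Zupan trisections of `S⁴`
of Disproof §6, then MonodromyAlt(3, A₅, O). WHY IT MIGHT FAIL: per-orbit Venn counts of some
homotopy-sphere trisection differ from the standard ones (= ¬crux, a theorem of independent
interest), or `G_O` is imprimitive/small at genus `3+3m` for some `T` with the two configurations in
different `G_O`-orbits. Implied by the crux; for `g ≫ |T|` a theorem modulo vendoring DT (and, for
the Venn lift, the exact pair normalisation of item 14592 or a direct count). Size L.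
Sources: DunfieldThurston2005 arXiv:math/0502567 Thm 7.4, Hall 1936, GilmanEvans (T-systems),
AbramsGayKirby2018, card semisimple-venn-monodromy + TRIAGE r1-3. -/
def SemisimpleTopStep : Prop :=
  ∀ (m : ℕ) (K : TrisectionKernels (3 + 3 * m)),
    IsGroupTrisection (3 + 3 * m) (m + 1) (PUnit : Type) K →
    ∀ M : Subgroup (S m), M.Characteristic → M.FiniteIndex →
    (∀ X : Subgroup (S m), X.Characteristic → M < X → X = ⊤) →
    ¬ ⁅(⊤ : Subgroup (S m)), (⊤ : Subgroup (S m))⁆ ≤ M →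
    ShadowStandardAt m K M

/-! ## 4. DEEP NON-ABELIAN CHIEF LAYERS (the hard residual)

Stub 4 · `stub_nonabelianDeep` · for every `(3+3m; m+1)` group trisection `K` of `{1}` and every
pair of characteristic finite-index levels `M < L` with `L ≠ S`, `L/M` an `Aut S`-CHIEF factor (no
characteristic subgroup strictly between) that is NON-ABELIAN (`⁅L,L⁆ ≰ M`), if `K` is standard on
the nose at level `L` then its level-`M` shadow is standard.

OBJECT. `L/M` is characteristically simple non-abelian, `≅ T^n`; `L = π₁(Σ̃_L)` is itself a surface
group (genus `1 + |Q|(g-1)`, `Q = S/L`) and by coinduction `Hom(L,T) = Hom_Q(S, T ≀ Q)`, so the layer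
is a piece of the TOP semisimple stratum of the cover `Σ̃_L` — but the acting group is only the
level-`L` triple stabiliser `Γ(L) ⊆ Aut S`, whose image in `Mod(Σ̃_L)` is the LIFTABLE mapping class
group (finite index, NOT all of `Mod(Σ̃_L)`): Dunfield–Thurston mixing for `Mod(Σ̃_L)` does not
transfer, and the genus cannot be pumped (card, dead end "genus pumping"; barrier note B-DT: "it does
bite; the bet is that isolating it as ONE stub over explicit finite `Mod`-sets (Hall coordinates for
`T ≀ Q`) is progress"). In Hall coordinates the statement is again a subset-triple transitivity, now
for `G := im(Γ(L) → Sym(O_L))`, `O_L ⊆ Epi(L,T)/Aut T` the `Aut S`-orbit of factors of `L/M` (on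
which `Γ(L)` may have several orbits), with per-orbit cell counts as the computable kill criterion. FIRST INSTANCE: `m = 0`, `L = [S,S]S²` (`Q = (ℤ/2)⁶`, `Σ̃_L` of
genus 129), `T = A₅`: not enumerable (`|Hom(L, A₅)| ~ 60^{258}`); reachable only structurally
(quotients `S ↠ A₅ ≀ (ℤ/2)⁶` compatible with the level-`L` data). WHY IT MIGHT FAIL: the liftable
mapping class group acts with several orbits on admissible configurations of a deep layer while all
shallower shadows agree — the first place a formally non-standard homotopy-sphere trisection could
hide; no asymptotic theorem covers it. Implied by the crux. Size: open-problem-sized (XL+); HARDEST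
stub of the line. Sources: DunfieldThurston2005, Hall 1936, card prym-layer-stable-rank §(4),
GrunewaldLarsenLubotzkyMalestein2015 arXiv:1307.2593 (liftable subgroups), Looijenga 1997. -/
def NonabelianDeepStep : Prop :=
  ∀ (m : ℕ) (K : TrisectionKernels (3 + 3 * m)),
    IsGroupTrisection (3 + 3 * m) (m + 1) (PUnit : Type) K →
    ∀ M L : Subgroup (S m), M.Characteristic → M.FiniteIndex → L.Characteristic → L.FiniteIndex →
    M < L → L ≠ ⊤ → (∀ X : Subgroup (S m), X.Characteristic → M < X → X ≤ L → X = L) →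
    ¬ ⁅L, L⁆ ≤ M →
    NormalisedAt m K L →
    ∃ ψ : S m ≃* S m, ∀ i : Fin 3, (N m i ⊔ M).map ψ.toMonoidHom = K i ⊔ M

/-! ## Registered stubs -/

/-- STUB 1 (tame abelian Prym layers; size L; first instance = item 14599 mod `n`, then the
`(3,2,3)` Prym rung). -/
theorem stub_tameAbelianLayer : TameAbelianLayerStep := by
  sorry

/-- STUB 2 (wild abelian Prym layers; size XL; contains the finite truncations of item 14594;
first instance = LT(M₂,2) at genus 3, `dim V = 258`). -/
theorem stub_wildAbelianLayer : WildAbelianLayerStep := by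
  sorry

/-- STUB 3 (semisimple top stratum, per `Out S`-orbit; size L; asymptotic theorem by
Dunfield–Thurston, first fixed-genus instance `(3, A₅)` kit-scale). -/
theorem stub_semisimpleTop : SemisimpleTopStep := by
  sorry

/-- STUB 4 (deep non-abelian chief layers relative to a standard level; the LOAD-BEARING hard
residual, wreath-product / liftable-mapping-class-group regime). -/
theorem stub_nonabelianDeep : NonabelianDeepStep := by
  sorry

/-! ## 5. The chief-layer descent (sorry-free glue = the card's `ChiefLayerReduction`, PROVED) -/

/-- The subgroups containing a finite-index normal subgroup form a finite set (they inject into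
the subgroup lattice of the finite quotient). -/
theorem finite_setOf_le (M : Subgroup (S m)) [M.Normal] [M.FiniteIndex] :
    Set.Finite {X : Subgroup (S m) | M ≤ X} := by
  refine Set.Finite.of_finite_image (f := fun X : Subgroup (S m) => X.map (QuotientGroup.mk' M))
    (Set.toFinite _) ?_
  intro X hX Y hY hXY
  have e := congrArg (Subgroup.comap (QuotientGroup.mk' M)) hXY
  have hXk : (QuotientGroup.mk' M).ker ≤ X := by rw [QuotientGroup.ker_mk']; exact hX
  have hYk : (QuotientGroup.mk' M).ker ≤ Y := by rw [QuotientGroup.ker_mk']; exact hY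
  simpa only [Subgroup.comap_map_eq_self hXk, Subgroup.comap_map_eq_self hYk] using e

/-- **Chief layers exist.** A proper characteristic finite-index `M` has a MINIMAL characteristic
overgroup `L ⊋ M`; `L/M` is then an `Aut S`-chief factor (no characteristic subgroup strictly
between), hence characteristically simple (`≅ T^n`). -/
theorem exists_minimal_char_gt {M : Subgroup (S m)} (hM : M.Characteristic) [M.FiniteIndex]
    (hne : M ≠ ⊤) :
    ∃ L : Subgroup (S m), L.Characteristic ∧ M < L ∧
      ∀ X : Subgroup (S m), X.Characteristic → M < X → X ≤ L → X = L := by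
  haveI : M.Characteristic := hM
  have hfin : Set.Finite {X : Subgroup (S m) | X.Characteristic ∧ M < X} :=
    (finite_setOf_le M).subset fun X hX => hX.2.le
  have hne' : Set.Nonempty {X : Subgroup (S m) | X.Characteristic ∧ M < X} :=
    ⟨⊤, inferInstance, lt_top_iff_ne_top.2 hne⟩
  obtain ⟨L, hLmem, hLmin⟩ := hfin.exists_minimal hne'
  refine ⟨L, hLmem.1, hLmem.2, fun X hX hMX hXL => ?_⟩
  exact le_antisymm hXL (hLmin ⟨hX, hMX⟩ hXL)

/-- **DESCENT (the chief-layer induction).** From the four layer statements, every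
characteristic finite-index level is standard: strong induction on the index, one chief layer at a
time below a standard level. -/
theorem descent (h₁ : TameAbelianLayerStep) (h₂ : WildAbelianLayerStep) (h₃ : SemisimpleTopStep)
    (h₄ : NonabelianDeepStep) {K : TrisectionKernels (3 + 3 * m)}
    (hK : IsGroupTrisection (3 + 3 * m) (m + 1) (PUnit : Type) K) :
    ∀ (n : ℕ) (M : Subgroup (S m)), M.Characteristic → M.FiniteIndex → M.index = n →
      ShadowStandardAt m K M := by
  intro n
  induction n using Nat.strong_induction_on with
  | _ n ih =>
    intro M hM hMf hn
    haveI : M.FiniteIndex := hMf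
    by_cases htop : M = ⊤
    · subst htop
      exact standardAt_top K
    -- a chief layer `L ⊋ M`
    obtain ⟨L, hLc, hML, hchief⟩ := exists_minimal_char_gt hM htop
    haveI : L.FiniteIndex := Subgroup.finiteIndex_of_le hML.le
    -- the upper level is standard by induction (smaller index)
    have hLstd : ShadowStandardAt m K L :=
      ih L.index (lt_of_lt_of_eq (Subgroup.index_strictAnti hML) hn) L hLc inferInstance rfl
    by_cases hab : ⁅L, L⁆ ≤ M
    · -- ABELIAN chief layer: Stub 1 (tame) or Stub 2 (wild), relative to the level `L`
      refine standardAt_of_relative hK hLc hM hLstd fun K' hK' hlev => ?_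
      by_cases hco : Nat.Coprime L.index (M.relIndex L)
      · exact h₁ m K' hK' L M hLc inferInstance hM hMf hML hchief hab hco hlev
      · exact h₂ m K' hK' L M hLc inferInstance hM hMf hML hchief hab hco hlev
    · by_cases hLtop : L = ⊤
      · -- NON-ABELIAN TOP layer: Stub 3 (M is maximal characteristic, S/M non-abelian)
        subst hLtop
        exact h₃ m K hK M hM hMf (fun X hX hMX => hchief X hX hMX le_top) hab
      · -- NON-ABELIAN DEEP layer: Stub 4, relative to the level `L`
        refine standardAt_of_relative hK hLc hM hLstd fun K' hK' hlev => ?_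
        exact h₄ m K' hK' M L hM hMf hLc inferInstance hML hLtop hchief hab hlev

/-- **The crux at one level from the four parts** (pure logic, kernel-checked; conclusion
`ShadowStandardAt`, so that `ShadowsStandard_of` below is the unique theorem of this file concluding
the crux by name). -/
theorem standardAt_of_parts (h₁ : TameAbelianLayerStep) (h₂ : WildAbelianLayerStep)
    (h₃ : SemisimpleTopStep) (h₄ : NonabelianDeepStep) (m : ℕ) (K : TrisectionKernels (3 + 3 * m))
    (hK : IsGroupTrisection (3 + 3 * m) (m + 1) (PUnit : Type) K) (M : Subgroup (S m))
    (hM : M.Characteristic) (hMf : M.FiniteIndex) : ShadowStandardAt m K M :=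
  descent h₁ h₂ h₃ h₄ hK _ M hM hMf rfl

/-- **Composition.** The four registered stubs prove the crux `CongruenceShadows.ShadowsStandard`
BY NAME. -/
theorem ShadowsStandard_of :
    _root_.Summit.SmoothPoincare4.SmoothPoincare4.Theses.CongruenceShadows.ShadowsStandard :=
  fun m K hK M hM hMf => standardAt_of_parts stub_tameAbelianLayer stub_wildAbelianLayer
    stub_semisimpleTop stub_nonabelianDeep m K hK M hM hMf

/-! ## 6. Certificates (sorry-free)

(a) Every stub is a CONSEQUENCE of the crux (no stub is a strengthening that could die while the
crux lives) — `stubs_of_shadowsStandard`.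
(b) Disproof §4 sharpened to the abelian layer step: with `IsGroupTrisection` dropped, the tame
step is false at the very first layer `(M, M') = (⊤, M_{ℤ/2})`, `m = 0`, witness `K = ⊥`
(`tame_false_without_trisection`); with `M'.Characteristic` dropped it is false at `(⊤, ker χ_{b₂})`
for the relabelled standard triple `rotatedKernels` (`tame_false_without_characteristic`). Both
reuse the landed witnesses of `Negative/ShadowLevels.lean`; both are stated for the layer step
WITHOUT the chief hypothesis (which holds at `(⊤, M_{ℤ/2}) = (⊤, [S,S]S²)` — `Sp₆(𝔽₂)` is
irreducible on `𝔽₂⁶` — but is not formalised here), so they bear on Stub 1 verbatim. -/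

/-- (a) The crux implies each of the four stubs. -/
theorem stubs_of_shadowsStandard (h : ShadowsStandard) :
    TameAbelianLayerStep ∧ WildAbelianLayerStep ∧ SemisimpleTopStep ∧ NonabelianDeepStep := by
  refine ⟨?_, ?_, ?_, ?_⟩
  · intro m K hK M M' _ _ hM' hM'f _ _ _ _ _
    exact h m K hK M' hM' hM'f
  · intro m K hK M M' _ _ hM' hM'f _ _ _ _ _
    exact h m K hK M' hM' hM'f
  · intro m K hK M hM hMf _ _
    exact h m K hK M hM hMf
  · intro m K hK M L hM hMf _ _ _ _ _ _ _
    exact h m K hK M hM hMf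

/-- The level `M_{ℤ/2} = ⋂ ker (S_3 →* ℤ/2)` contains the commutator subgroup (an abelian layer
below `⊤`). -/
theorem commutator_le_levelSubgroup_zmod2 :
    ⁅(⊤ : Subgroup (SurfaceGroup 3)), (⊤ : Subgroup (SurfaceGroup 3))⁆ ≤
      levelSubgroup 3 (Multiplicative (ZMod 2)) := by
  show _ ≤ ⨅ φ : SurfaceGroup 3 →* Multiplicative (ZMod 2), φ.ker
  exact le_iInf fun φ => Abelianization.commutator_subset_ker φ

/-- (b₁) **`IsGroupTrisection` is load-bearing in the abelian layer step** (Stub 1 without the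
chief hypothesis; witness layer `(⊤, M_{ℤ/2})`, `K = ⊥`). -/
theorem tame_false_without_trisection :
    ¬ ∀ (m : ℕ) (K : TrisectionKernels (3 + 3 * m)) (M M' : Subgroup (S m)),
        M.Characteristic → M.FiniteIndex → M'.Characteristic → M'.FiniteIndex →
        M' ≤ M → ⁅M, M⁆ ≤ M' → Nat.Coprime M.index (M'.relIndex M) → NormalisedAt m K M →
        ∃ ψ : S m ≃* S m, ∀ i : Fin 3, (N m i ⊔ M').map ψ.toMonoidHom = K i ⊔ M' := by
  intro h
  have hco : Nat.Coprime (⊤ : Subgroup (SurfaceGroup 3)).index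
      ((levelSubgroup 3 (Multiplicative (ZMod 2))).relIndex ⊤) := by
    rw [Subgroup.index_top]
    exact Nat.coprime_one_left _
  obtain ⟨ψ, hψ⟩ := h 0 (fun _ => ⊥) ⊤ (levelSubgroup 3 (Multiplicative (ZMod 2)))
    inferInstance inferInstance (levelSubgroup_characteristic 3 _) (levelSubgroup_finiteIndex 3 _)
    le_top commutator_le_levelSubgroup_zmod2 hco (fun i => by simp)
  apply levelSubgroup_zmod2_ne_top
  rw [eq_top_iff, ← iSup_s4Kernels_eq_top, iSup_le_iff]
  intro i
  have hi := hψ i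
  rw [bot_sup_eq] at hi
  have key : s4Kernels i ⊔ levelSubgroup 3 (Multiplicative (ZMod 2)) =
      levelSubgroup 3 (Multiplicative (ZMod 2)) := by
    have := congrArg (Subgroup.comap ψ.toMonoidHom) hi
    rwa [Subgroup.comap_map_eq_self_of_injective ψ.injective,
      (levelSubgroup_characteristic 3 (Multiplicative (ZMod 2))).fixed ψ] at this
  exact le_sup_left.trans key.le

/-- The index-`2` level `ker χ_{b₂}` contains the commutator subgroup. -/
theorem commutator_le_ker_genChar :
    ⁅(⊤ : Subgroup (SurfaceGroup 3)), (⊤ : Subgroup (SurfaceGroup 3))⁆ ≤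
      (genChar (((1 : Fin 3), true) : surfaceGen 3)).ker :=
  Abelianization.commutator_subset_ker _

/-- (b₂) **`M'.Characteristic` is load-bearing in the abelian layer step** (Stub 1 without the
chief hypothesis; witness layer `(⊤, ker χ_{b₂})`, `K` = the relabelled standard triple). -/
theorem tame_false_without_characteristic :
    ¬ ∀ (m : ℕ) (K : TrisectionKernels (3 + 3 * m)),
        IsGroupTrisection (3 + 3 * m) (m + 1) (PUnit : Type) K →
        ∀ M M' : Subgroup (S m), M.Characteristic → M.FiniteIndex → M'.FiniteIndex →
        M' ≤ M → ⁅M, M⁆ ≤ M' → Nat.Coprime M.index (M'.relIndex M) → NormalisedAt m K M →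
        ∃ ψ : S m ≃* S m, ∀ i : Fin 3, (N m i ⊔ M').map ψ.toMonoidHom = K i ⊔ M' := by
  intro h
  have hco : Nat.Coprime (⊤ : Subgroup (SurfaceGroup 3)).index
      ((genChar (((1 : Fin 3), true) : surfaceGen 3)).ker.relIndex ⊤) := by
    rw [Subgroup.index_top]
    exact Nat.coprime_one_left _
  obtain ⟨ψ, hψ⟩ := h 0 rotatedKernels rotatedKernels_isGroupTrisection ⊤
    (genChar (((1 : Fin 3), true) : surfaceGen 3)).ker inferInstance inferInstance inferInstance
    le_top commutator_le_ker_genChar hco (fun i => by simp)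
  have h0 := hψ 0
  have hl : N 0 0 ⊔ (genChar (((1 : Fin 3), true) : surfaceGen 3)).ker =
      (genChar (((1 : Fin 3), true) : surfaceGen 3)).ker :=
    sup_eq_right.2 s4Kernels_zero_le_ker
  have hr : rotatedKernels 0 ⊔ (genChar (((1 : Fin 3), true) : surfaceGen 3)).ker = ⊤ :=
    s4Kernels_one_sup_ker_eq_top
  rw [hl, hr] at h0
  have htop : (genChar (((1 : Fin 3), true) : surfaceGen 3)).ker = ⊤ := by
    have := congrArg (Subgroup.comap ψ.toMonoidHom) h0
    rwa [Subgroup.comap_map_eq_self_of_injective ψ.injective, Subgroup.comap_top] at this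
  exact of_not_mem_ker_genChar _
    (htop ▸ Subgroup.mem_top (PresentedGroup.of (((1 : Fin 3), true) : surfaceGen 3)))

end Summit.SmoothPoincare4.SmoothPoincare4.Cruxes.ShadowsStandard.PrymLayerStableRank

end
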